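import Mathlib
import Literature.NumberTheory.LFunctions.Zhang2022.Section6Statements
import Literature.NumberTheory.LFunctions.Zhang2022.Section5Lemma51
import HarnessLib

/-!
# Zhang (2022), §6 p. 32: "`I′ = −Z(s,ψ)N(1−s,ψ̄) + O(ε)`" — the node `Z22:§6.u015` PROVED

Topic `Literature/NumberTheory/LFunctions/Zhang2022` (Landau–Siegel audit tree; verdict-neutral).
Y. Zhang, *Discrete mean estimates and the Landau–Siegel zero*, arXiv:2211.02515v1 (2022)
[Zhang2022LandauSiegel] — **an unrefereed manuscript under adjudication; nothing in this file asserts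
or denies its Theorems 1–2.** Campaign D-0069, discharge block F4 (L2): the leaf claim of the proof
of Lemma 6.1 (§6, PDF p. 32, tex L1774 of `lsz3__2_.tex`)

> Replacing the segment `u = −1`, `|v| ≤ 𝓛²⁰` by `u = −1` and using the change of variable
> `w → −w`, we obtain `I′ = −Z(s,ψ)N(1−s,ψ̄) + O(ε)`,

typed statement-exact as `Section6Statements.Step6u015` (over the typed objects `Iprime`,
`integrand64`, `headSum`, `vseg` and the banked `Skeleton.Nchar`, `Skeleton.gstar`,
`GammaFactor.Zfac`), is PROVED here: `theorem step6u015_holds : Step6u015` (kernel-checked, no new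
facts, no hypotheses beyond the node's own; constants `c = 1/16`, `C = 2`, all `D ≥ ⌈e³⌉`).

The proof is the printed one, made explicit with the tree's §4 toolkit
(`Section4GaussianWeight`: `ω₁`, `g`, the Mellin–Perron kernel `K_y(v) = y^{1+iv}ω₁(1+iv)/(1+iv)`
and (4.1) as `GaussWeight.integral_kernel'`, (4.3) as `GaussWeight.gWeight_le`):

* `term_reflect`, `line_integral_eq` — "the change of variable `w → −w`": on the whole line
  `u = −1`, `(1/2πi)∫_{(−1)} (Σ_{n<T³} ψ̄(n)n^{−(1−s−w)})T^{−2w}ω₁(w)dw/w = −Σ_{n<T³} ψ̄(n)n^{−(1−s)}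
  g(T²/n)` (`ω₁` even, `n^wT^{−2w} = (T²/n)^{−w}`, then (4.1) at `c = 1`);
* `head_sub_Nchar_le` — this is `−N(1−s,ψ̄) = −Σ_{n<2T²} ψ̄(n)n^{−(1−s)}g*(T²/n)` up to the terms
  `2T² ≤ n < T³`, each `≤ ½e^{−𝓛³⁰log²2}` by (4.3) (`g*(y) = g(y)` for `y > 1/2`);
* `line_sub_seg_le` — "replacing the segment … by [the line]": the two half-lines `|v| > 𝓛²⁰`
  cost `≤ ⌈T³⌉T²e^{1/(4𝓛³⁰)}√(8π𝓛³⁰)·e^{−𝓛¹⁰/8}` by the trivial bound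
  `|ω₁(−1+iv)| = e^{(1−v²)/(4𝓛³⁰)}` (`integrand_bound`);
* `norm_Zfac_le_exp` — the one input the sentence leaves implicit, `Z(s,ψ) ≪ 1` in the range of
  Lemma 6.1: `|Z(s,ψ)| ≤ e¹³` from the tree's Stirling bound
  `GammaFactor.norm_Zfac_le_exp_of_abs_sub_half_le` (as in `Section5Lemma51`);
* `final_bound` — the sizes against `ε = e^{−𝓛¹⁰/16}` (`T = e^{𝓛^{1.1}}`, `𝓛 ≥ 3`).

| DAG node | decl | status |
|---|---|---|
| `Z22:§6.u015` (p. 32, tex L1774) | `Section6Statements.step6u015_holds : Step6u015` | PROVED |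

Deliberately NOT here: the edge `DedEq61` ("reduced to showing (6.3)", which silently drops the
`n < T³` part of the integral on `u = −1, |v| > 𝓛²⁰` and needs the growth of `Z(s+w,ψ)` on that
line) — a separate append; any claim about Theorems 1–2 of the source.

## References

* Y. Zhang, arXiv:2211.02515v1 (2022), §6 p. 32 (proof of Lemma 6.1, (6.3)–(6.4) and the sentence
  after (6.5)); §4 p. 18–19 ((4.1), (4.3), `ω₁`, `ε`); §5 Lemma 5.1 (proof: `|Z(s,ψ)|`).
  [cite: Zhang2022LandauSiegel, §6 p.32 tex L1774]
* H. L. Montgomery, R. C. Vaughan, *Multiplicative Number Theory I* (CUP 2007), §5.1 (5.15)–(5.16)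
  (Mellin–Perron weights), Thm C.1 (Stirling) — consumed through the tree files cited above.
  [cite: MontgomeryVaughan2007, §5.1]
-/

noncomputable section

open Complex Real Set MeasureTheory

namespace Literature.NumberTheory.LFunctions.Zhang2022.Section6Statements

open Skeleton GaussWeight

/-! ## A. The change of variable `w → −w` on the line `u = −1`, termwise -/

/-- `1 + iv ≠ 0`. [folklore] -/
private theorem one_add_ne_zero (v : ℝ) : (1 : ℂ) + v * I ≠ 0 := by
  intro h
  have := congrArg Complex.re h
  simp at this

/-- `−1 + iv ≠ 0`. [folklore] -/
private theorem neg_one_add_ne_zero (v : ℝ) : (-1 : ℂ) + v * I ≠ 0 := by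
  intro h
  have := congrArg Complex.re h
  simp at this

/-- The printed "change of variable `w → −w`", termwise: at `w = −(1+iv)`,
`a·n^{−(1−s−w)}·T^{−2w}ω₁(w)/w = −(a·n^{−(1−s)})·K_{T²/n}(v)` with the tree's Mellin–Perron kernel
`K_y(v) = y^{1+iv}ω₁(1+iv)/(1+iv)` (`ω₁` is even, `n^{w}T^{−2w} = (T²/n)^{−w}`).
[cite: Zhang2022LandauSiegel, §6 p.32, tex L1774] -/
private theorem term_reflect {Λ T : ℝ} (hT : 0 < T) {n : ℕ} (hn : n ≠ 0) (a s : ℂ) (v : ℝ) :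
    a * (n : ℂ) ^ (-(1 - s - (-(1 + v * I)))) * (T : ℂ) ^ (-(2 * (-(1 + v * I)))) *
        omega1 Λ (-(1 + v * I)) / (-(1 + v * I))
      = -(a * (n : ℂ) ^ (-(1 - s)) * kernel Λ 1 (T ^ 2 / n) v) := by
  have hn' : (0 : ℝ) < n := Nat.cast_pos.mpr (Nat.pos_of_ne_zero hn)
  have hTn : 0 < T ^ 2 / n := div_pos (pow_pos hT 2) hn'
  have hω : omega1 Λ (-(1 + v * I)) = omega1 Λ (1 + v * I) := by simp only [omega1, neg_sq]
  have e1 : (n : ℂ) ^ (-(1 - s - (-(1 + v * I))))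
      = (n : ℂ) ^ (-(1 - s)) * cexp (-(1 + v * I) * Real.log n) := by
    rw [show -(1 - s - (-(1 + v * I))) = -(1 - s) + (-(1 + v * I)) by ring,
      Complex.cpow_add _ _ (Nat.cast_ne_zero.mpr hn)]
    congr 1
    rw [show (n : ℂ) = ((n : ℝ) : ℂ) by norm_cast, cpow_eq_exp_log hn']
  have e2 : (T : ℂ) ^ (-(2 * (-(1 + v * I)))) = cexp (2 * (1 + v * I) * Real.log T) := by
    rw [cpow_eq_exp_log hT]
    congr 1
    ring
  have e3 : ((T ^ 2 / n : ℝ) : ℂ) ^ (((1 : ℝ) : ℂ) + v * I)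
      = cexp ((1 + v * I) * (2 * Real.log T - Real.log n)) := by
    rw [cpow_eq_exp_log hTn, Real.log_div (pow_pos hT 2).ne' hn'.ne', Real.log_pow]
    congr 1
    push_cast
    ring
  have e4 : cexp (-(1 + v * I) * Real.log n) * cexp (2 * (1 + v * I) * Real.log T)
      = cexp ((1 + v * I) * (2 * Real.log T - Real.log n)) := by
    rw [← Complex.exp_add]
    congr 1
    ring
  have h1 : ((1 : ℝ) : ℂ) + v * I = 1 + v * I := by push_cast; ring
  rw [kernel, e3, h1, e1, e2, hω, div_neg, neg_inj, ← e4]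
  ring

/-- The full line `u = −1` after `w → −w`: `∫_ℝ (Σ_{n∈S} aₙn^{−(1−s−w)})T^{−2w}ω₁(w)w⁻¹ dv`
(`w = −1 + iv`) `= −2π Σ_{n∈S} aₙ n^{−(1−s)} g(T²/n)` (the tree's `GaussWeight.integral_kernel'`,
i.e. (4.1) `(2πi)⁻¹∫_{(1)} y^w ω₁(w)dw/w = g(y)`). [cite: Zhang2022LandauSiegel, §6 p.32, tex L1774] -/
private theorem line_integral_eq {Λ T : ℝ} (hΛ : 0 < Λ) (hT : 0 < T) (S : Finset ℕ) (hS : 0 ∉ S)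
    (a : ℕ → ℂ) (s : ℂ) :
    ∫ v : ℝ, (∑ n ∈ S, a n * (n : ℂ) ^ (-(1 - s - ((-1 : ℂ) + v * I)))) *
        (T : ℂ) ^ (-(2 * ((-1 : ℂ) + v * I))) * omega1 Λ ((-1 : ℂ) + v * I) / ((-1 : ℂ) + v * I)
      = -(2 * π * ∑ n ∈ S, a n * (n : ℂ) ^ (-(1 - s)) * (gWeight Λ (T ^ 2 / n) : ℂ)) := by
  set F : ℝ → ℂ := fun v => (∑ n ∈ S, a n * (n : ℂ) ^ (-(1 - s - ((-1 : ℂ) + v * I)))) *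
        (T : ℂ) ^ (-(2 * ((-1 : ℂ) + v * I))) * omega1 Λ ((-1 : ℂ) + v * I) / ((-1 : ℂ) + v * I)
    with hF
  have hflip : ∫ v, F v = ∫ v, F (-v) := (integral_neg_eq_self F volume).symm
  have h2 : ∀ v : ℝ, F (-v) = -∑ n ∈ S, a n * (n : ℂ) ^ (-(1 - s)) * kernel Λ 1 (T ^ 2 / n) v := by
    intro v
    have h1 : ((-1 : ℂ) + ((-v : ℝ) : ℂ) * I) = -(1 + v * I) := by push_cast; ring
    simp only [hF, h1]
    rw [Finset.sum_mul, Finset.sum_mul, Finset.sum_div, ← Finset.sum_neg_distrib]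
    refine Finset.sum_congr rfl fun n hn => ?_
    exact term_reflect hT (fun h => hS (h ▸ hn)) (a n) s v
  show ∫ v, F v = _
  rw [hflip]
  simp only [h2]
  rw [integral_neg, integral_finsetSum _ (fun n hn => ?_)]
  · rw [Finset.mul_sum, ← Finset.sum_neg_distrib, ← Finset.sum_neg_distrib]
    refine Finset.sum_congr rfl fun n hn => ?_
    have hn' : (0 : ℝ) < n := Nat.cast_pos.mpr (Nat.pos_of_ne_zero (fun h => hS (h ▸ hn)))
    rw [integral_const_mul, GaussWeight.integral_kernel' hΛ one_pos (div_pos (pow_pos hT 2) hn')]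
    ring
  · have hn' : (0 : ℝ) < n := Nat.cast_pos.mpr (Nat.pos_of_ne_zero (fun h => hS (h ▸ hn)))
    exact (GaussWeight.integrable_kernel hΛ one_pos (div_pos (pow_pos hT 2) hn')).const_mul _

/-! ## B. Size and continuity of the integrand of (6.4) on `u = −1` -/

/-- On `w = −1 + iv`: `|(Σ_{n∈S} aₙn^{−(1−s−w)})T^{−2w}ω₁(w)/w| ≤ #S·T²·e^{(1−v²)/(4Λ)}` for
`|aₙ| ≤ 1`, `0 ∉ S`, `σ ≤ 2`, `T ≥ 1` (`|n^{−(1−s−w)}| = n^{σ−2} ≤ 1`, `|T^{−2w}| = T²`,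
`|ω₁(−1+iv)| = e^{(1−v²)/(4Λ)}`, `|w| ≥ 1`). [cite: Zhang2022LandauSiegel, §6 p.32, tex L1774] -/
private theorem integrand_bound {Λ T : ℝ} (hT : 0 < T) (S : Finset ℕ) (hS : 0 ∉ S)
    {a : ℕ → ℂ} (ha : ∀ n, ‖a n‖ ≤ 1) {s : ℂ} (hs : s.re ≤ 2) (v : ℝ) :
    ‖(∑ n ∈ S, a n * (n : ℂ) ^ (-(1 - s - ((-1 : ℂ) + v * I)))) *
        (T : ℂ) ^ (-(2 * ((-1 : ℂ) + v * I))) * omega1 Λ ((-1 : ℂ) + v * I) / ((-1 : ℂ) + v * I)‖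
      ≤ S.card * T ^ 2 * Real.exp ((1 - v ^ 2) / (4 * Λ)) := by
  have hsum : ‖∑ n ∈ S, a n * (n : ℂ) ^ (-(1 - s - ((-1 : ℂ) + v * I)))‖ ≤ S.card := by
    calc ‖∑ n ∈ S, a n * (n : ℂ) ^ (-(1 - s - ((-1 : ℂ) + v * I)))‖
        ≤ ∑ n ∈ S, ‖a n * (n : ℂ) ^ (-(1 - s - ((-1 : ℂ) + v * I)))‖ := norm_sum_le _ _
      _ ≤ ∑ n ∈ S, (1 : ℝ) := by
          refine Finset.sum_le_sum fun n hn => ?_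
          have hn0 : n ≠ 0 := fun h => hS (h ▸ hn)
          have hn1 : (1 : ℝ) ≤ n := by exact_mod_cast Nat.one_le_iff_ne_zero.mpr hn0
          rw [norm_mul, Complex.norm_natCast_cpow_of_pos (Nat.pos_of_ne_zero hn0)]
          have hre : (-(1 - s - ((-1 : ℂ) + v * I))).re = s.re - 2 := by simp; ring
          rw [hre]
          have h2 : (n : ℝ) ^ (s.re - 2) ≤ 1 :=
            Real.rpow_le_one_of_one_le_of_nonpos hn1 (by linarith)
          calc ‖a n‖ * (n : ℝ) ^ (s.re - 2) ≤ 1 * 1 :=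
                mul_le_mul (ha n) h2 (Real.rpow_nonneg (by positivity) _) zero_le_one
            _ = 1 := one_mul _
      _ = S.card := by simp
  have hTw : ‖(T : ℂ) ^ (-(2 * ((-1 : ℂ) + v * I)))‖ = T ^ 2 := by
    rw [Complex.norm_cpow_eq_rpow_re_of_pos hT]
    have hre : (-(2 * ((-1 : ℂ) + v * I))).re = 2 := by simp
    rw [hre, Real.rpow_two]
  have hω : ‖omega1 Λ ((-1 : ℂ) + v * I)‖ = Real.exp ((1 - v ^ 2) / (4 * Λ)) := by
    have h := norm_omega1 Λ (-1) v
    push_cast at h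
    rw [h]
    norm_num
  have hw : 1 ≤ ‖(-1 : ℂ) + v * I‖ := by
    have h := Complex.abs_re_le_norm ((-1 : ℂ) + v * I)
    simp at h
    exact h
  rw [norm_div, norm_mul, norm_mul, hTw, hω]
  calc ‖∑ n ∈ S, a n * (n : ℂ) ^ (-(1 - s - ((-1 : ℂ) + v * I)))‖ * T ^ 2 *
          Real.exp ((1 - v ^ 2) / (4 * Λ)) / ‖(-1 : ℂ) + v * I‖
      ≤ ‖∑ n ∈ S, a n * (n : ℂ) ^ (-(1 - s - ((-1 : ℂ) + v * I)))‖ * T ^ 2 *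
          Real.exp ((1 - v ^ 2) / (4 * Λ)) := div_le_self (by positivity) hw
    _ ≤ S.card * T ^ 2 * Real.exp ((1 - v ^ 2) / (4 * Λ)) := by gcongr

/-- The integrand of (6.4) is continuous in `v` on the line `u = −1`. [folklore] -/
private theorem integrand_continuous (Λ : ℝ) {T : ℝ} (hT : 0 < T) (S : Finset ℕ) (hS : 0 ∉ S)
    (a : ℕ → ℂ) (s : ℂ) :
    Continuous fun v : ℝ => (∑ n ∈ S, a n * (n : ℂ) ^ (-(1 - s - ((-1 : ℂ) + v * I)))) *
        (T : ℂ) ^ (-(2 * ((-1 : ℂ) + v * I))) * omega1 Λ ((-1 : ℂ) + v * I) / ((-1 : ℂ) + v * I) := by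
  have h1 : Continuous fun v : ℝ => ∑ n ∈ S, a n * (n : ℂ) ^ (-(1 - s - ((-1 : ℂ) + v * I))) := by
    refine continuous_finsetSum S fun n hn => ?_
    have hn0 : (n : ℂ) ≠ 0 := Nat.cast_ne_zero.mpr (fun h => hS (h ▸ hn))
    exact continuous_const.mul (Continuous.const_cpow (by fun_prop) (Or.inl hn0))
  have h2 : Continuous fun v : ℝ => (T : ℂ) ^ (-(2 * ((-1 : ℂ) + v * I))) :=
    Continuous.const_cpow (by fun_prop) (Or.inl (ofReal_ne_zero.mpr hT.ne'))
  have h3 : Continuous fun v : ℝ => omega1 Λ ((-1 : ℂ) + v * I) := by unfold omega1; fun_prop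
  have h4 : Continuous fun v : ℝ => ((-1 : ℂ) + v * I) := by fun_prop
  exact ((h1.mul h2).mul h3).div h4 (fun v => neg_one_add_ne_zero v)

/-! ## C. "Replacing the segment `u = −1, |v| ≤ 𝓛²⁰` by `u = −1`": the Gaussian tail -/

/-- For a continuous `f` with `|f(v)| ≤ B·e^{(1−v²)/(4Λ)}`: `f` is integrable on `ℝ` and
`|∫_ℝ f − ∫_{−V}^{V} f| ≤ B·e^{1/(4Λ)}·√(8πΛ)·e^{−V²/(8Λ)}` (on `|v| ≥ V`,
`e^{−v²/(4Λ)} ≤ e^{−V²/(8Λ)}e^{−v²/(8Λ)}`, and `∫_ℝ e^{−v²/(8Λ)}dv = √(8πΛ)`) — the printed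
"replacing the segment … by [the line]" at the cost `O(ε)`. [cite: Zhang2022LandauSiegel, §6 p.32, tex L1774] -/
private theorem line_sub_seg_le {Λ V B : ℝ} (hΛ : 0 < Λ) (hV : 0 ≤ V) (hB : 0 ≤ B) {f : ℝ → ℂ}
    (hf : Continuous f) (hb : ∀ v, ‖f v‖ ≤ B * Real.exp ((1 - v ^ 2) / (4 * Λ))) :
    Integrable f ∧
    ‖(∫ v, f v) - ∫ v in (-V)..V, f v‖
      ≤ B * Real.exp (1 / (4 * Λ)) * Real.sqrt (8 * π * Λ) * Real.exp (-V ^ 2 / (8 * Λ)) := by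
  have hsplit : ∀ v : ℝ, Real.exp ((1 - v ^ 2) / (4 * Λ))
      = Real.exp (1 / (4 * Λ)) * Real.exp (-(1 / (4 * Λ)) * v ^ 2) := by
    intro v
    rw [← Real.exp_add]
    congr 1
    ring
  have hg0 : Integrable (fun v : ℝ => B * Real.exp (1 / (4 * Λ)) * Real.exp (-(1 / (4 * Λ)) * v ^ 2)) :=
    (integrable_exp_neg_mul_sq (by positivity)).const_mul _
  have hint : Integrable f := by
    refine hg0.mono' hf.aestronglyMeasurable (ae_of_all _ (fun v => ?_))
    rw [mul_assoc, ← hsplit v]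
    exact hb v
  refine ⟨hint, ?_⟩
  set K : ℝ := B * Real.exp (1 / (4 * Λ)) * Real.exp (-V ^ 2 / (8 * Λ)) with hK
  have hK0 : 0 ≤ K := by positivity
  have hmeas : MeasurableSet (Ioc (-V) V) := measurableSet_Ioc
  rw [intervalIntegral.integral_of_le (by linarith : -V ≤ V), ← integral_add_compl hmeas hint,
    add_sub_cancel_left]
  have hg1 : Integrable (fun v : ℝ => K * Real.exp (-(1 / (8 * Λ)) * v ^ 2)) :=
    (integrable_exp_neg_mul_sq (by positivity)).const_mul _
  have hptw : ∀ v ∈ (Ioc (-V) V)ᶜ, ‖f v‖ ≤ K * Real.exp (-(1 / (8 * Λ)) * v ^ 2) := by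
    intro v hv
    have hv' : V ^ 2 ≤ v ^ 2 := by
      simp only [mem_compl_iff, mem_Ioc, not_and, not_le] at hv
      rcases le_or_gt v (-V) with h | h
      · nlinarith
      · have h2 := hv h
        nlinarith
    refine (hb v).trans ?_
    rw [hK, mul_assoc, mul_assoc, ← Real.exp_add, ← Real.exp_add]
    refine mul_le_mul_of_nonneg_left (Real.exp_le_exp.mpr ?_) hB
    rw [div_le_iff₀ (by positivity : (0 : ℝ) < 4 * Λ)]
    have h8 : (1 / (4 * Λ) + (-V ^ 2 / (8 * Λ) + -(1 / (8 * Λ)) * v ^ 2)) * (4 * Λ)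
        = 1 - V ^ 2 / 2 - v ^ 2 / 2 := by
      field_simp
      ring
    rw [h8]
    linarith
  calc ‖∫ v in (Ioc (-V) V)ᶜ, f v‖
      ≤ ∫ v in (Ioc (-V) V)ᶜ, K * Real.exp (-(1 / (8 * Λ)) * v ^ 2) :=
        norm_integral_le_of_norm_le hg1.integrableOn
          ((ae_restrict_iff' hmeas.compl).mpr (ae_of_all _ hptw))
    _ ≤ ∫ v, K * Real.exp (-(1 / (8 * Λ)) * v ^ 2) :=
        setIntegral_le_integral hg1 (ae_of_all _ (fun v => by positivity))
    _ = K * Real.sqrt (π / (1 / (8 * Λ))) := by rw [integral_const_mul, integral_gaussian]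
    _ = B * Real.exp (1 / (4 * Λ)) * Real.sqrt (8 * π * Λ) * Real.exp (-V ^ 2 / (8 * Λ)) := by
        rw [hK, show π / (1 / (8 * Λ)) = 8 * π * Λ by field_simp]
        ring

/-! ## D. `Σ_{n<T³}` against `N(1−s,ψ̄)` (`n < 2T²`): the terms `2T² ≤ n < T³` are `O(ε)` by (4.3) -/

/-- For `|θ(n)| ≤ 1`, `σ < 1`, `2T² ≤ T³` and `𝓛 > 0`:
`|Σ_{n<T³} θ(n)n^{−(1−s)}g(T²/n) − N(1−s,θ)| ≤ ⌈T³⌉·½e^{−𝓛³⁰ log²2}` — for `n < 2T²` the weights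
agree (`g*(T²/n) = g(T²/n)` as `T²/n > 1/2`), and for `n ≥ 2T²` (4.3) gives
`g(T²/n) ≤ ½exp{−𝓛³⁰log²(T²/n)} ≤ ½exp{−𝓛³⁰ log²2}` (the tree's `GaussWeight.gWeight_le`).
[cite: Zhang2022LandauSiegel, §6 p.32, tex L1774; §4 (4.3)] -/
private theorem head_sub_Nchar_le {D : ℕ} (hΛ : 0 < ell D ^ 30) (hT : 2 * bigT D ^ 2 ≤ bigT D ^ 3)
    (θ : ℕ → ℂ) (hθ : ∀ n, ‖θ n‖ ≤ 1) {s : ℂ} (hs : s.re < 1) :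
    ‖(∑ n ∈ Finset.Ico 1 ⌈bigT D ^ 3⌉₊,
        θ n * (n : ℂ) ^ (-(1 - s)) * (gW D (bigT D ^ 2 / n) : ℂ)) - Nchar D θ (1 - s)‖
      ≤ ⌈bigT D ^ 3⌉₊ * ((1 / 2) * Real.exp (-(ell D ^ 30) * Real.log 2 ^ 2)) := by
  set S := Finset.Ico 1 ⌈bigT D ^ 3⌉₊ with hSdef
  set S' := Finset.Ico 1 ⌈2 * bigT D ^ 2⌉₊ with hS'def
  have hT0 : 0 < bigT D := Real.exp_pos _
  have hsub : S' ⊆ S := Finset.Ico_subset_Ico_right (Nat.ceil_mono hT)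
  have hN : Nchar D θ (1 - s)
      = ∑ n ∈ S', θ n * (n : ℂ) ^ (-(1 - s)) * (gW D (bigT D ^ 2 / n) : ℂ) := by
    rw [Nchar]
    refine Finset.sum_congr rfl fun n hn => ?_
    rw [Finset.mem_Ico] at hn
    have hn0 : (0 : ℝ) < n := by exact_mod_cast hn.1
    have hlt : (n : ℝ) < 2 * bigT D ^ 2 := Nat.lt_ceil.mp hn.2
    have hhalf : 1 / 2 < bigT D ^ 2 / n := by
      rw [lt_div_iff₀ hn0]
      linarith
    rw [gstar, if_pos hhalf]
  rw [hN, ← Finset.sum_sdiff hsub, add_sub_cancel_right]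
  have hterm : ∀ n ∈ S \ S',
      ‖θ n * (n : ℂ) ^ (-(1 - s)) * (gW D (bigT D ^ 2 / n) : ℂ)‖
        ≤ (1 / 2) * Real.exp (-(ell D ^ 30) * Real.log 2 ^ 2) := by
    intro n hn
    rw [Finset.mem_sdiff, Finset.mem_Ico, Finset.mem_Ico, not_and, not_lt] at hn
    obtain ⟨⟨hn1, _⟩, hn2⟩ := hn
    have hge : ⌈2 * bigT D ^ 2⌉₊ ≤ n := hn2 hn1
    have hn0 : (0 : ℝ) < n := by exact_mod_cast hn1
    have hn1' : (1 : ℝ) ≤ n := by exact_mod_cast hn1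
    have hge' : 2 * bigT D ^ 2 ≤ n := Nat.ceil_le.mp hge
    have hy0 : 0 < bigT D ^ 2 / n := div_pos (pow_pos hT0 2) hn0
    have hy1 : bigT D ^ 2 / n ≤ 1 / 2 := by
      rw [div_le_iff₀ hn0]
      linarith
    have hg0 : 0 < gW D (bigT D ^ 2 / n) := gWeight_pos hΛ _
    have hg : gW D (bigT D ^ 2 / n) ≤ (1 / 2) * Real.exp (-(ell D ^ 30) * Real.log 2 ^ 2) := by
      refine (gWeight_le hΛ hy0 (by linarith)).trans ?_
      refine mul_le_mul_of_nonneg_left (Real.exp_le_exp.mpr ?_) (by norm_num)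
      have hlog : Real.log (bigT D ^ 2 / n) ≤ -Real.log 2 := by
        have h := Real.log_le_log hy0 hy1
        rwa [one_div, Real.log_inv] at h
      have h2 : 0 ≤ Real.log 2 := Real.log_nonneg one_le_two
      have hsq : Real.log 2 ^ 2 ≤ Real.log (bigT D ^ 2 / n) ^ 2 := by
        rw [← neg_sq (Real.log (bigT D ^ 2 / n))]
        exact pow_le_pow_left₀ h2 (by linarith) 2
      nlinarith
    rw [norm_mul, norm_mul, Complex.norm_natCast_cpow_of_pos hn1, Complex.norm_real,
      Real.norm_of_nonneg hg0.le]
    have hre : (-(1 - s)).re = -(1 - s.re) := by simp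
    rw [hre]
    have hpow : (n : ℝ) ^ (-(1 - s.re)) ≤ 1 :=
      Real.rpow_le_one_of_one_le_of_nonpos hn1' (by linarith)
    calc ‖θ n‖ * (n : ℝ) ^ (-(1 - s.re)) * gW D (bigT D ^ 2 / n)
        ≤ 1 * 1 * ((1 / 2) * Real.exp (-(ell D ^ 30) * Real.log 2 ^ 2)) :=
          mul_le_mul (mul_le_mul (hθ n) hpow (Real.rpow_nonneg hn0.le _) zero_le_one) hg hg0.le
            (by norm_num)
      _ = (1 / 2) * Real.exp (-(ell D ^ 30) * Real.log 2 ^ 2) := by ring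
  calc ‖∑ n ∈ S \ S', θ n * (n : ℂ) ^ (-(1 - s)) * (gW D (bigT D ^ 2 / n) : ℂ)‖
      ≤ ∑ n ∈ S \ S', ‖θ n * (n : ℂ) ^ (-(1 - s)) * (gW D (bigT D ^ 2 / n) : ℂ)‖ := norm_sum_le _ _
    _ ≤ ∑ n ∈ S \ S', (1 / 2) * Real.exp (-(ell D ^ 30) * Real.log 2 ^ 2) := Finset.sum_le_sum hterm
    _ = (S \ S').card * ((1 / 2) * Real.exp (-(ell D ^ 30) * Real.log 2 ^ 2)) := by
        rw [Finset.sum_const, nsmul_eq_mul]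
    _ ≤ ⌈bigT D ^ 3⌉₊ * ((1 / 2) * Real.exp (-(ell D ^ 30) * Real.log 2 ^ 2)) := by
        gcongr
        calc (S \ S').card ≤ S.card := Finset.card_le_card Finset.sdiff_subset
          _ = ⌈bigT D ^ 3⌉₊ - 1 := Nat.card_Ico _ _
          _ ≤ ⌈bigT D ^ 3⌉₊ := Nat.sub_le _ _

/-! ## E. `|Z(s,ψ)| ≤ e¹³` in the range of Lemma 6.1 (Stirling, via the tree's Lemma 5.1 input) -/

/-- `𝓛 ≥ 3` once `D ≥ ⌈e³⌉`. [cite: Zhang2022LandauSiegel, §2 (2.1)] -/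
private theorem three_le_ell {D : ℕ} (hD : ⌈Real.exp 3⌉₊ ≤ D) : 3 ≤ ell D := by
  have h : Real.exp 3 ≤ D := le_trans (Nat.le_ceil _) (by exact_mod_cast hD)
  exact (Real.le_log_iff_exp_le (lt_of_lt_of_le (Real.exp_pos _) h)).mpr h

/-- `2α = 2π𝓛⁻⁹ ≤ 1/4` for `𝓛 ≥ 3`. [cite: Zhang2022LandauSiegel, §2 (2.10)] -/
private theorem two_alpha_le_loc {D : ℕ} (hL : 3 ≤ ell D) : 2 * alpha D ≤ 1 / 4 := by
  have hα : alpha D = π / ell D ^ 9 := by rw [alpha, bigP, Real.log_exp]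
  have hL9 : (3 : ℝ) ^ 9 ≤ ell D ^ 9 := pow_le_pow_left₀ (by norm_num) hL 9
  rw [hα, mul_div_assoc', div_le_iff₀ (by positivity)]
  nlinarith [Real.pi_lt_four]

/-- The window `p ∼ P`: `P < p < P(1 + 𝓛⁻⁶⁸)`. [cite: Zhang2022LandauSiegel, §2 p. 4] -/
private theorem window {D : ℕ} (x : Chr D) :
    bigP D < x.p ∧ (x.p : ℝ) < bigP D * (1 + (ell D ^ 68)⁻¹) := by
  have hm := x.mem
  rw [primeWindow, Finset.mem_filter, Finset.mem_Ioo] at hm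
  have hP : 0 ≤ bigP D := (Real.exp_pos _).le
  exact ⟨(Nat.floor_lt hP).mp hm.1.1, Nat.lt_ceil.mp hm.1.2⟩

/-- The `t`-range `|t − 2πt₀| < 𝓛₁ + 2` gives `5𝓛⁵¹⁹ ≤ t ≤ 8𝓛⁵¹⁹`.
[cite: Zhang2022LandauSiegel, §2 (2.8)] -/
private theorem t_range_loc {L t : ℝ} (hL : 3 ≤ L) (ht : |t - 2 * π * L ^ 519| < L ^ 405 + 2) :
    5 * L ^ 519 ≤ t ∧ t ≤ 8 * L ^ 519 := by
  have hL1 : 1 ≤ L := by linarith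
  have hL0 : 0 < L := by linarith
  have h114 : 9 ≤ L ^ 114 := by
    have h : L ^ 2 ≤ L ^ 114 := pow_le_pow_right₀ hL1 (by norm_num)
    nlinarith
  have h405 : L ^ 405 + 2 ≤ L ^ 519 := by
    have h1 : (1 : ℝ) ≤ L ^ 405 := one_le_pow₀ hL1
    calc L ^ 405 + 2 ≤ L ^ 405 * 9 := by nlinarith
      _ ≤ L ^ 405 * L ^ 114 := by gcongr
      _ = L ^ 519 := by rw [← pow_add]
  obtain ⟨ht1, ht2⟩ := abs_lt.mp ht
  have hπa : 3 * L ^ 519 ≤ π * L ^ 519 :=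
    mul_le_mul_of_nonneg_right Real.pi_gt_three.le (by positivity)
  have hπb : π * L ^ 519 ≤ 3.15 * L ^ 519 :=
    mul_le_mul_of_nonneg_right Real.pi_lt_d2.le (by positivity)
  exact ⟨by linarith, by linarith⟩

/-- `|log(kt/2π)| ≤ 2𝓛⁹` for `1 ≤ k`, `log k ≤ 𝓛⁹ + 𝓛 + 1`, `5𝓛⁵¹⁹ ≤ t ≤ 8𝓛⁵¹⁹`.
[cite: Zhang2022LandauSiegel, §5 Lemma 5.1 (proof)] -/
private theorem abs_log_kt_le {L t K : ℝ} (hL : 3 ≤ L) (ht5 : 5 * L ^ 519 ≤ t)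
    (ht8 : t ≤ 8 * L ^ 519) (hK1 : 1 ≤ K) (hK : Real.log K ≤ L ^ 9 + L + 1) :
    |Real.log (K * t / (2 * π))| ≤ 2 * L ^ 9 := by
  have hL1 : 1 ≤ L := by linarith
  have hL0 : 0 < L := by linarith
  have hK0 : 0 < K := by linarith
  have h519 : (1 : ℝ) ≤ L ^ 519 := one_le_pow₀ hL1
  have h519' : (3 : ℝ) ≤ L ^ 519 := hL.trans (le_self_pow₀ hL1 (by norm_num))
  have ht0 : 0 < t := by linarith
  have hy1 : 1 ≤ K * t / (2 * π) := by
    rw [le_div_iff₀ (by positivity), one_mul]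
    have hKt : t ≤ K * t := le_mul_of_one_le_left ht0.le hK1
    linarith [Real.pi_lt_four]
  rw [abs_of_nonneg (Real.log_nonneg hy1), mul_div_assoc, Real.log_mul hK0.ne' (by positivity)]
  have hlogt : Real.log (t / (2 * π)) ≤ 3 + 519 * L := by
    have h1 : t / (2 * π) ≤ 8 * L ^ 519 := by
      rw [div_le_iff₀ (by positivity)]; nlinarith [Real.pi_gt_three, pow_pos hL0 519]
    have h2 : 0 < t / (2 * π) := by positivity
    calc Real.log (t / (2 * π)) ≤ Real.log (8 * L ^ 519) := Real.log_le_log h2 h1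
      _ = Real.log 8 + 519 * Real.log L := by
          rw [Real.log_mul (by norm_num) (by positivity), Real.log_pow]; push_cast; ring
      _ ≤ 3 + 519 * L := by
          have h8 : Real.log 8 ≤ 3 := by
            rw [show (8 : ℝ) = 2 ^ 3 by norm_num, Real.log_pow]; push_cast
            linarith [Real.log_two_lt_d9]
          have hLL : Real.log L ≤ L := (Real.log_le_sub_one_of_pos hL0).trans (by linarith)
          linarith
  have h9 : 520 * L + 4 ≤ L ^ 9 := by
    have h1 : L ^ 9 = L * L ^ 8 := by ring
    have h8 : (3 : ℝ) ^ 8 ≤ L ^ 8 := pow_le_pow_left₀ (by norm_num) hL 8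
    nlinarith
  linarith

/-- **The implicit input `|Z(s,ψ)| ≪ 1`**: for `D ≥ ⌈e³⌉`, `ψ ∈ Ψ` and `s` in the range of Lemma
6.1, `|Z(s,ψ)| ≤ e¹³` — from the tree's `GammaFactor.norm_Zfac_le_exp_of_abs_sub_half_le`
(`|Z(σ+it,θ)| ≤ exp(|σ − 1/2|(|log(kt/2π)| + 14/t))`, Stirling) with `|σ − 1/2| < 2α = 2π𝓛⁻⁹`,
`log(pt/2π) ≤ 2𝓛⁹`. [cite: Zhang2022LandauSiegel, §6 p.32, tex L1774; §5 Lemma 5.1 (proof)] -/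
private theorem norm_Zfac_le_exp {D : ℕ} (hD : ⌈Real.exp 3⌉₊ ≤ D) (x : Chr D) {s : ℂ}
    (hs : InRange61 D s) : ‖GammaFactor.Zfac x.ψ s‖ ≤ Real.exp 13 := by
  have hL3 : 3 ≤ ell D := three_le_ell hD
  have hL0 : 0 < ell D := by linarith
  have hL1 : 1 ≤ ell D := by linarith
  obtain ⟨σ, t, rfl⟩ : ∃ σ' t' : ℝ, s = σ' + t' * I := ⟨s.re, s.im, (re_add_im s).symm⟩
  obtain ⟨hσ, htr⟩ := hs
  have hσ' : |σ - 1 / 2| < 2 * alpha D := by simpa using hσ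
  have htr' : |t - 2 * π * ell D ^ 519| < ell D ^ 405 + 2 := by
    have h := htr
    rw [ell1, t0] at h
    simpa using h
  have hα : alpha D = π / ell D ^ 9 := by rw [alpha, bigP, Real.log_exp]
  obtain ⟨ht5, ht8⟩ := t_range_loc hL3 htr'
  have h519 : (1 : ℝ) ≤ ell D ^ 519 := one_le_pow₀ hL1
  have ht4 : 4 ≤ t := by linarith
  have ht0 : 0 < t := by linarith
  have h9pos : 0 < ell D ^ 9 := by positivity
  have hL9 : (3 : ℝ) ^ 9 ≤ ell D ^ 9 := pow_le_pow_left₀ (by norm_num) hL3 9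
  have hσ4 : |σ - 1 / 2| ≤ 1 / 4 := hσ'.le.trans (two_alpha_le_loc hL3)
  obtain ⟨hPp, hpP⟩ := window x
  have hP0 : 0 < bigP D := Real.exp_pos _
  have hlogP : Real.log (bigP D) = ell D ^ 9 := by rw [bigP, Real.log_exp]
  have hp0 : (0 : ℝ) < x.p := hP0.trans hPp
  have hp1 : (1 : ℝ) ≤ x.p := by exact_mod_cast x.prime.one_lt.le
  have hlogp : Real.log (x.p : ℝ) ≤ ell D ^ 9 + ell D + 1 := by
    have h68 : (ell D ^ 68)⁻¹ ≤ 1 := inv_le_one_of_one_le₀ (one_le_pow₀ hL1)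
    have h4 : (x.p : ℝ) ≤ bigP D * 2 :=
      hpP.le.trans (mul_le_mul_of_nonneg_left (by linarith) hP0.le)
    calc Real.log (x.p : ℝ) ≤ Real.log (bigP D * 2) := Real.log_le_log hp0 h4
      _ = ell D ^ 9 + Real.log 2 := by rw [Real.log_mul hP0.ne' two_ne_zero, hlogP]
      _ ≤ ell D ^ 9 + ell D + 1 := by linarith [Real.log_two_lt_d9]
  have hlog : |Real.log ((x.p : ℝ) * t / (2 * π))| ≤ 2 * ell D ^ 9 :=
    abs_log_kt_le hL3 ht5 ht8 hp1 hlogp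
  have h14 : 14 / t ≤ 4 := by rw [div_le_iff₀ ht0]; linarith
  refine (GammaFactor.norm_Zfac_le_exp_of_abs_sub_half_le x.prim hσ4 ht4).trans
    (Real.exp_le_exp.mpr ?_)
  have ha : |σ - 1 / 2| ≤ 2 * π / ell D ^ 9 := by
    rw [hα, ← mul_div_assoc] at hσ'
    exact hσ'.le
  calc |σ - 1 / 2| * (|Real.log ((x.p : ℝ) * t / (2 * π))| + 14 / t)
      ≤ (2 * π / ell D ^ 9) * (2 * ell D ^ 9 + 4) :=
        mul_le_mul ha (by linarith) (by positivity) (by positivity)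
    _ = 4 * π + 8 * π / ell D ^ 9 := by field_simp; ring
    _ ≤ 13 := by
        have h : 8 * π / ell D ^ 9 ≤ 1 / 100 := by
          rw [div_le_iff₀ h9pos]; nlinarith [Real.pi_lt_four]
        linarith [Real.pi_lt_d2]

/-! ## F. The final comparison of sizes: everything is `≤ 2e^{−𝓛¹⁰/16}` -/

/-- The two error terms against `ε = e^{−𝓛¹⁰/16}` (`T = e^{𝓛^{1.1}} ≤ e^{𝓛²}`, `𝓛 ≥ 3`):
`e¹³(2π)⁻¹·⌈T³⌉T²e^{1/(4𝓛³⁰)}√(8π𝓛³⁰)e^{−𝓛¹⁰/8} + e¹³⌈T³⌉½e^{−𝓛³⁰log²2} ≤ 2e^{−𝓛¹⁰/16}`.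
[cite: Zhang2022LandauSiegel, §6 p.32, tex L1774; §4 p.19 (`ε`)] -/
private theorem final_bound {L : ℝ} (hL : 3 ≤ L) :
    Real.exp 13 * (1 / (2 * π)) *
        ((⌈Real.exp (L ^ (1.1 : ℝ)) ^ 3⌉₊ : ℝ) * Real.exp (L ^ (1.1 : ℝ)) ^ 2 *
          Real.exp (1 / (4 * L ^ 30)) * Real.sqrt (8 * π * L ^ 30) *
          Real.exp (-(L ^ 20) ^ 2 / (8 * L ^ 30)))
      + Real.exp 13 * ((⌈Real.exp (L ^ (1.1 : ℝ)) ^ 3⌉₊ : ℝ) *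
          ((1 / 2) * Real.exp (-(L ^ 30) * Real.log 2 ^ 2)))
      ≤ 2 * Real.exp (-(1 / 16) * L ^ 10) := by
  set T := Real.exp (L ^ (1.1 : ℝ)) with hT
  have hL0 : 0 < L := by linarith
  have hL1 : 1 ≤ L := by linarith
  have hT0 : 0 < T := Real.exp_pos _
  have hT1 : 1 ≤ T := Real.one_le_exp (by positivity)
  have hTL : T ≤ Real.exp (L ^ 2) := by
    refine Real.exp_le_exp.mpr ?_
    have h := Real.rpow_le_rpow_of_exponent_le hL1 (show (1.1 : ℝ) ≤ 2 by norm_num)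
    rwa [Real.rpow_two] at h
  have hceil : (⌈T ^ 3⌉₊ : ℝ) ≤ 2 * T ^ 3 := by
    have h := Nat.ceil_lt_add_one (show 0 ≤ T ^ 3 by positivity)
    have h1 : 1 ≤ T ^ 3 := one_le_pow₀ hT1
    linarith
  have hL2 : (6561 : ℝ) * L ^ 2 ≤ L ^ 10 := by
    have h8 : (3 : ℝ) ^ 8 ≤ L ^ 8 := pow_le_pow_left₀ (by norm_num) hL 8
    have h : L ^ 10 = L ^ 8 * L ^ 2 := by ring
    rw [h]; nlinarith [pow_pos hL0 2]
  have hL30 : (16 : ℝ) * L ^ 10 ≤ L ^ 30 := by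
    have h20 : (3 : ℝ) ^ 20 ≤ L ^ 20 := pow_le_pow_left₀ (by norm_num) hL 20
    have h : L ^ 30 = L ^ 20 * L ^ 10 := by ring
    rw [h]; nlinarith [pow_pos hL0 10]
  -- the exponential bounds on the polynomial-size factors
  have hT3 : T ^ 3 ≤ Real.exp (3 * L ^ 2) := by
    calc T ^ 3 ≤ Real.exp (L ^ 2) ^ 3 := pow_le_pow_left₀ hT0.le hTL 3
      _ = Real.exp (3 * L ^ 2) := by rw [← Real.exp_nat_mul]; norm_num
  have hT5 : (⌈T ^ 3⌉₊ : ℝ) * T ^ 2 ≤ 2 * Real.exp (5 * L ^ 2) := by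
    calc (⌈T ^ 3⌉₊ : ℝ) * T ^ 2 ≤ 2 * T ^ 3 * T ^ 2 := by gcongr
      _ = 2 * T ^ 5 := by ring
      _ ≤ 2 * Real.exp (L ^ 2) ^ 5 := by gcongr
      _ = 2 * Real.exp (5 * L ^ 2) := by rw [← Real.exp_nat_mul]; norm_num
  have hΛ1 : Real.exp (1 / (4 * L ^ 30)) ≤ Real.exp 1 := by
    refine Real.exp_le_exp.mpr ?_
    rw [div_le_iff₀ (by positivity)]
    nlinarith [one_le_pow₀ hL1 (n := 30)]
  have hsqrt : Real.sqrt (8 * π * L ^ 30) ≤ Real.exp (4 + 30 * L) := by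
    have h30 : (1 : ℝ) ≤ L ^ 30 := one_le_pow₀ hL1
    have h1 : 1 ≤ 8 * π * L ^ 30 := by nlinarith [Real.pi_gt_three]
    have hLe : L ^ 30 ≤ Real.exp (30 * L) := by
      have h := Real.add_one_le_exp L
      calc L ^ 30 ≤ Real.exp L ^ 30 := pow_le_pow_left₀ hL0.le (by linarith) 30
        _ = Real.exp (30 * L) := by rw [← Real.exp_nat_mul]; norm_num
    have h4 : (32 : ℝ) ≤ Real.exp 4 := by
      have h := Real.exp_one_gt_d9
      calc (32 : ℝ) ≤ 2.7182818283 ^ 4 := by norm_num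
        _ ≤ Real.exp 1 ^ 4 := pow_le_pow_left₀ (by norm_num) h.le 4
        _ = Real.exp 4 := by rw [← Real.exp_nat_mul]; norm_num
    calc Real.sqrt (8 * π * L ^ 30) ≤ 8 * π * L ^ 30 := Real.sqrt_le_iff.mpr ⟨by positivity, by nlinarith⟩
      _ ≤ 32 * L ^ 30 := by nlinarith [Real.pi_lt_four]
      _ ≤ Real.exp 4 * Real.exp (30 * L) := mul_le_mul h4 hLe (by positivity) (Real.exp_pos _).le
      _ = Real.exp (4 + 30 * L) := by rw [← Real.exp_add]
  have hV : Real.exp (-(L ^ 20) ^ 2 / (8 * L ^ 30)) = Real.exp (-(L ^ 10 / 8)) := by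
    congr 1
    rw [div_eq_iff (by positivity)]
    ring
  have hπ : 1 / (2 * π) ≤ (1 : ℝ) := by
    rw [div_le_iff₀ (by positivity)]; nlinarith [Real.pi_gt_three]
  have hlog2 : (1 : ℝ) / 4 ≤ Real.log 2 ^ 2 := by nlinarith [Real.log_two_gt_d9]
  -- piece 1
  have h1 : Real.exp 13 * (1 / (2 * π)) *
        ((⌈T ^ 3⌉₊ : ℝ) * T ^ 2 * Real.exp (1 / (4 * L ^ 30)) * Real.sqrt (8 * π * L ^ 30) *
          Real.exp (-(L ^ 20) ^ 2 / (8 * L ^ 30)))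
      ≤ Real.exp (-(1 / 16) * L ^ 10) := by
    rw [hV]
    calc Real.exp 13 * (1 / (2 * π)) *
          ((⌈T ^ 3⌉₊ : ℝ) * T ^ 2 * Real.exp (1 / (4 * L ^ 30)) * Real.sqrt (8 * π * L ^ 30) *
            Real.exp (-(L ^ 10 / 8)))
        ≤ Real.exp 13 * 1 * ((2 * Real.exp (5 * L ^ 2)) * Real.exp 1 * Real.exp (4 + 30 * L) *
            Real.exp (-(L ^ 10 / 8))) := by gcongr
      _ = 2 * Real.exp (13 + 5 * L ^ 2 + 1 + (4 + 30 * L) + -(L ^ 10 / 8)) := by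
          simp only [Real.exp_add]; ring
      _ ≤ Real.exp 1 * Real.exp (13 + 5 * L ^ 2 + 1 + (4 + 30 * L) + -(L ^ 10 / 8)) := by
          gcongr
          have h := Real.add_one_le_exp (1 : ℝ)
          linarith
      _ = Real.exp (19 + 5 * L ^ 2 + 30 * L - L ^ 10 / 8) := by rw [← Real.exp_add]; ring_nf
      _ ≤ Real.exp (-(1 / 16) * L ^ 10) := Real.exp_le_exp.mpr (by nlinarith)
  -- piece 2
  have h2 : Real.exp 13 * ((⌈T ^ 3⌉₊ : ℝ) * ((1 / 2) * Real.exp (-(L ^ 30) * Real.log 2 ^ 2)))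
      ≤ Real.exp (-(1 / 16) * L ^ 10) := by
    calc Real.exp 13 * ((⌈T ^ 3⌉₊ : ℝ) * ((1 / 2) * Real.exp (-(L ^ 30) * Real.log 2 ^ 2)))
        ≤ Real.exp 13 * ((2 * Real.exp (3 * L ^ 2)) * ((1 / 2) * Real.exp (-(L ^ 30) / 4))) := by
          gcongr
          · exact hceil.trans (by linarith)
          · nlinarith [pow_pos hL0 30]
      _ = Real.exp (13 + 3 * L ^ 2 + -(L ^ 30) / 4) := by simp only [Real.exp_add]; ring
      _ ≤ Real.exp (-(1 / 16) * L ^ 10) := Real.exp_le_exp.mpr (by nlinarith)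
  linarith

/-! ## G. The node `Z22:§6.u015`: `I′ = −Z(s,ψ)N(1−s,ψ̄) + O(ε)` -/

/-- `Z22:§6.u015` PROVED. §6 p. 32: "Replacing the segment `u = −1, |v| ≤ 𝓛²⁰` by `u = −1` and
using the change of variable `w → −w`, we obtain `I′ = −Z(s,ψ)N(1−s,ψ̄) + O(ε)`" — the typed claim
`Section6Statements.Step6u015` HOLDS, with `ε = e^{−𝓛¹⁰/16}`, `C = 2`, all `D ≥ ⌈e³⌉` (the
antecedent (A) is not used). Proof as printed: on the full line `u = −1`, `w → −w` and (4.1)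
(`GaussWeight.integral_kernel'`) give `(1/2πi)∫_{(−1)}(Σ_{n<T³}ψ̄(n)n^{−(1−s−w)})T^{−2w}ω₁(w)dw/w
= −Σ_{n<T³}ψ̄(n)n^{−(1−s)}g(T²/n)`, which is `−N(1−s,ψ̄)` up to the terms `2T² ≤ n < T³` where
`g(T²/n) ≤ ½e^{−𝓛³⁰log²2}` by (4.3); the two half-lines `|v| > 𝓛²⁰` cost
`≤ ⌈T³⌉T²e^{1/(4𝓛³⁰)}√(8π𝓛³⁰)e^{−𝓛¹⁰/8}` by the trivial bound `|ω₁(−1+iv)| = e^{(1−v²)/(4𝓛³⁰)}`;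
and `|Z(s,ψ)| ≤ e¹³` in the range (Stirling, `GammaFactor.norm_Zfac_le_exp_of_abs_sub_half_le`).
No new facts; nothing about Theorems 1–2 of the source is asserted.
[cite: Zhang2022LandauSiegel, §6 p.32, tex L1774] -/
theorem step6u015_holds : Step6u015 := by
  refine ⟨1 / 16, by norm_num, 2, ⌈Real.exp 3⌉₊, fun D _ χ hD _ _ _ x s hs => ?_⟩
  -- parameters at `𝓛 ≥ 3`
  have hL3 : 3 ≤ ell D := three_le_ell hD
  have hL0 : 0 < ell D := by linarith
  have hL1 : 1 ≤ ell D := by linarith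
  have hΛ : 0 < ell D ^ 30 := by positivity
  have hT0 : 0 < bigT D := Real.exp_pos _
  have hT2 : 2 ≤ bigT D := by
    have h1 : (1 : ℝ) ≤ ell D ^ (1.1 : ℝ) := Real.one_le_rpow hL1 (by norm_num)
    have h2 := Real.add_one_le_exp (ell D ^ (1.1 : ℝ))
    rw [bigT]
    linarith
  have hT23 : 2 * bigT D ^ 2 ≤ bigT D ^ 3 := by nlinarith [pow_pos hT0 2]
  have hσ : s.re < 1 := by
    have h := (abs_lt.mp hs.1).2
    linarith [two_alpha_le_loc hL3]
  have hS0 : 0 ∉ Finset.Ico 1 ⌈bigT D ^ 3⌉₊ := by simp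
  have ha : ∀ n, ‖psiBarFn x n‖ ≤ 1 := fun n => by
    rw [psiBarFn, Complex.norm_conj]
    exact DirichletCharacter.norm_le_one _ _
  -- the objects
  set Z : ℂ := GammaFactor.Zfac x.ψ s with hZdef
  set V : ℝ := ell D ^ 20 with hVdef
  set S := Finset.Ico 1 ⌈bigT D ^ 3⌉₊ with hSdef
  set F : ℝ → ℂ := fun v => (∑ n ∈ S, psiBarFn x n * (n : ℂ) ^ (-(1 - s - ((-1 : ℂ) + v * I)))) *
      (bigT D : ℂ) ^ (-(2 * ((-1 : ℂ) + v * I))) * omega1 (ell D ^ 30) ((-1 : ℂ) + v * I) /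
        ((-1 : ℂ) + v * I) with hFdef
  set G : ℂ := ∑ n ∈ S, psiBarFn x n * (n : ℂ) ^ (-(1 - s)) * (gW D (bigT D ^ 2 / n) : ℂ)
    with hGdef
  set N : ℂ := Nchar D (psiBarFn x) (1 - s) with hNdef
  -- `I′ = Z·(1/2π)∫_{−V}^{V} F`
  have hI : Iprime x s = Z * ((1 / (2 * π) : ℂ) * ∫ v in (-V)..V, F v) := by
    simp only [Iprime, vseg, integrand64, headSum, hFdef, hZdef, hVdef, hSdef, ofReal_neg,
      ofReal_one]
  -- the full line: `(1/2π)∫_ℝ F = −G`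
  have hline : ∫ v, F v = -(2 * π * G) := by
    rw [hFdef, hGdef, line_integral_eq hΛ hT0 S hS0 (psiBarFn x) s]
    simp only [gW]
  -- the Gaussian tail
  have hb : ∀ v, ‖F v‖ ≤ (⌈bigT D ^ 3⌉₊ * bigT D ^ 2) * Real.exp ((1 - v ^ 2) / (4 * ell D ^ 30)) := by
    intro v
    refine (integrand_bound hT0 S hS0 ha (s := s) (by linarith) v).trans ?_
    gcongr
    rw [hSdef, Nat.card_Ico]
    exact Nat.sub_le _ _
  obtain ⟨_, htail⟩ := line_sub_seg_le hΛ (by positivity : (0 : ℝ) ≤ V) (by positivity)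
    (integrand_continuous (ell D ^ 30) hT0 S hS0 (psiBarFn x) s) hb
  -- `G` against `N(1−s,ψ̄)`
  have hGN : ‖G - N‖ ≤ ⌈bigT D ^ 3⌉₊ * ((1 / 2) * Real.exp (-(ell D ^ 30) * Real.log 2 ^ 2)) :=
    head_sub_Nchar_le hΛ hT23 (psiBarFn x) ha hσ
  -- `|Z(s,ψ)| ≤ e¹³`
  have hZ : ‖Z‖ ≤ Real.exp 13 := norm_Zfac_le_exp hD x hs
  -- assemble
  have hπ0 : (2 * π : ℂ) ≠ 0 := mul_ne_zero two_ne_zero (ofReal_ne_zero.mpr Real.pi_ne_zero)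
  have key : Iprime x s + Z * N
      = Z * (1 / (2 * π) : ℂ) * ((∫ v in (-V)..V, F v) - ∫ v, F v) - Z * (G - N) := by
    rw [hI, hline]
    field_simp
    ring
  have hnorm : ‖(1 / (2 * π) : ℂ)‖ = 1 / (2 * π) := by
    rw [show (1 / (2 * π) : ℂ) = ((1 / (2 * π) : ℝ) : ℂ) by push_cast; ring]
    exact Complex.norm_of_nonneg (by positivity)
  rw [key]
  calc ‖Z * (1 / (2 * π) : ℂ) * ((∫ v in (-V)..V, F v) - ∫ v, F v) - Z * (G - N)‖
      ≤ ‖Z * (1 / (2 * π) : ℂ) * ((∫ v in (-V)..V, F v) - ∫ v, F v)‖ + ‖Z * (G - N)‖ :=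
        norm_sub_le _ _
    _ = ‖Z‖ * (1 / (2 * π)) * ‖(∫ v, F v) - ∫ v in (-V)..V, F v‖ + ‖Z‖ * ‖G - N‖ := by
        rw [norm_mul, norm_mul, norm_mul, hnorm, norm_sub_rev]
    _ ≤ Real.exp 13 * (1 / (2 * π)) *
          ((⌈bigT D ^ 3⌉₊ * bigT D ^ 2) * Real.exp (1 / (4 * ell D ^ 30)) *
            Real.sqrt (8 * π * ell D ^ 30) * Real.exp (-V ^ 2 / (8 * ell D ^ 30)))
        + Real.exp 13 * (⌈bigT D ^ 3⌉₊ * ((1 / 2) * Real.exp (-(ell D ^ 30) * Real.log 2 ^ 2))) := by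
        gcongr
    _ ≤ 2 * Real.exp (-(1 / 16) * ell D ^ 10) := by
        have h := final_bound hL3
        rw [hVdef, bigT]
        exact h

/-- `Step6u015` — `_holds` alias of `step6u015_holds` above under the fact's exact name (appended
2026-08-28, D-0026 bookkeeping: the proof term is the existing theorem of this file; no statement,
definition or attribute is edited; no new named fact; the ledger's debt table listed the fact
unproved). [cite: Zhang2022LandauSiegel, §6 p.32, tex L1774] -/
theorem _root_.Literature.NumberTheory.LFunctions.Zhang2022.Section6Statements.Step6u015_holds :
    Step6u015 :=
  _root_.Literature.NumberTheory.LFunctions.Zhang2022.Section6Statements.step6u015_holds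

end Literature.NumberTheory.LFunctions.Zhang2022.Section6Statements
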